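import Literature.AnabelianGeometry.AbsoluteAnabelian.MonoidKummerMapsProofs
import Literature.AlgebraicGeometry.Frobenioids.Categories
import HarnessLib

/-!
# [AbsTopIII] Proposition 3.2 (iv), center-freeness portion — DISCHARGED in the printed form

Proof-only companion (theorems only, no definitions) of `MonoidKummerMaps.lean` (abc-iut-L4-t2;
S. Mochizuki, *Topics in absolute anabelian geometry III*, Prop. 3.2 (iv) p. 72, bib key
`MochizukiAbsTopIII2015`, lit key `paper:url-5493eb38cbb7`) and sequel of
`MonoidKummerMapsProofs.lean` (the injectivity half, `pairIsoDeterminedByGalois_holds`).  The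
center-freeness clause of Prop. 3.2 (iv) — "if `(Π ↷ M_T)` is of hyperbolic orbicurve type, then
`Aut((Π ↷ M_T))` … is center-free" — is typed by L4-t2 as the SCHEMA `AutPairCenterFree H` over a
hypothesis predicate `H` ("of hyperbolic orbicurve type", scheme-theoretic, TODO-merge abc-iut-L4-t1).
The printed proof is one sentence: "In light of this injectivity, the center-free-ness portion of
assertion (iv) follows immediately from the slimness of `Π` [cf., e.g., [Mzk20], Proposition 2.3,
(ii)]."  This file kernel-checks exactly that deduction: `AutPairCenterFree H` holds for EVERY `H`
under which `Π` has trivial centre (`autPairCenterFree_of_center_eq_bot`), in particular for every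
`H` under which `Π` is slim in the tree's sense `IsSlimGroup` (`autPairCenterFree_of_isSlimGroup`).
Argument: a central automorphism `e` of the pair commutes with the inner pair-automorphisms
`(conj g, g • ·)`, so `g⁻¹·e_Π(g)` is central in `Π`, hence `e_Π = id`, hence `e_M = id` by the
injectivity half.  The slimness of `Π` for pairs of hyperbolic orbicurve type is the anabelian input
([Mzk20] Prop. 2.3 (ii)) and stays where L4-t2 put it — in the hypothesis predicate.
HONEST FRAMING: OUR kernel check of a classical deduction in a refereed paper; it takes no side on
[IUTchIII] Cor. 3.12.
-/

noncomputable section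

namespace Literature.AnabelianGeometry.AbsoluteAnabelian

open Literature.AlgebraicGeometry.Frobenioids (IsSlimGroup)

/-- **[AbsTopIII] Prop. 3.2 (iv), center-freeness portion, in the printed form** ("In light of this
injectivity, the center-free-ness portion of assertion (iv) follows immediately from the slimness
of `Π`", p. 72): abc-iut-L4-t2's named schema `AutPairCenterFree H` holds for EVERY hypothesis
predicate `H` ("of hyperbolic orbicurve type") under which `Π` has trivial centre.  PROOF: a central
automorphism `e` of the pair commutes with the inner pair-automorphisms `(conj g, g • ·)`, so
`g⁻¹ · e_Π(g)` is central in `Π`, hence trivial; then `e_Π = id` and, by the injectivity half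
(`pairIsoDeterminedByGalois_holds`), `e_M = id`. [cite: MochizukiAbsTopIII2015, Proposition 3.2 (iv) p.72] -/
theorem autPairCenterFree_of_center_eq_bot {H : GaloisMonoidPair.{0} → Prop}
    (hZ : ∀ P : GaloisMonoidPair.{0}, IsMLFGaloisMonoidPair .TM P → H P →
      Subgroup.center P.Pi = ⊥) :
    AutPairCenterFree H := by
  intro P hP hH e _ hPi
  -- `e_Π` commutes with every inner automorphism (an automorphism of the pair)
  have hconj : ∀ g h : P.Pi, e.isoPi (g * h * g⁻¹) = g * e.isoPi h * g⁻¹ := by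
    intro g h
    let ι : GaloisMonoidPair.Iso P P :=
      { isoPi :=
          { toMulEquiv := MulAut.conj g
            continuous_toFun := (continuous_const.mul continuous_id).mul continuous_const
            continuous_invFun := (continuous_const.mul continuous_id).mul continuous_const }
        isoM := MulDistribMulAction.toMulAut P.Pi P.M g
        smul_comm := fun h x => by
          show g • (h • x) = (g * h * g⁻¹) • g • x
          rw [mul_smul, mul_smul, inv_smul_smul] }
    exact hPi ι h
  -- hence `g⁻¹ · e_Π(g)` is central, so `e_Π = id`
  have hid : ∀ g : P.Pi, e.isoPi g = g := by
    intro g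
    have hz : g⁻¹ * e.isoPi g ∈ Subgroup.center P.Pi := by
      rw [Subgroup.mem_center_iff]
      intro y
      obtain ⟨h, rfl⟩ := e.isoPi.surjective y
      have hc := hconj g h
      rw [map_mul, map_mul, map_inv] at hc
      calc e.isoPi h * (g⁻¹ * e.isoPi g)
          = g⁻¹ * (g * e.isoPi h * g⁻¹) * e.isoPi g := by group
        _ = g⁻¹ * (e.isoPi g * e.isoPi h * (e.isoPi g)⁻¹) * e.isoPi g := by rw [hc]
        _ = g⁻¹ * e.isoPi g * e.isoPi h := by group
    rw [hZ P hP hH, Subgroup.mem_bot, inv_mul_eq_one] at hz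
    exact hz.symm
  -- the identity automorphism of the pair has the same Galois component
  let ρ : GaloisMonoidPair.Iso P P :=
    { isoPi := ContinuousMulEquiv.refl P.Pi
      isoM := MulEquiv.refl P.M
      smul_comm := fun _ _ => rfl }
  have hePi : e.isoPi = ρ.isoPi := by
    ext g
    exact hid g
  have heM : e.isoM = ρ.isoM := pairIsoDeterminedByGalois_holds P P hP hP e ρ hePi
  exact ⟨fun x => by rw [heM]; rfl, hid⟩

/-- The same with the tree's slimness predicate (`IsSlimGroup`: centralisers of open subgroups are
trivial; in particular the centre — the centraliser of the open subgroup `Π` itself — is trivial):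
`AutPairCenterFree H` holds whenever `H` forces `Π` to be slim, which is the printed deduction
("follows immediately from the slimness of `Π` [cf., e.g., [Mzk20], Proposition 2.3, (ii)]").
[cite: MochizukiAbsTopIII2015, Proposition 3.2 (iv) p.72] -/
theorem autPairCenterFree_of_isSlimGroup {H : GaloisMonoidPair.{0} → Prop}
    (hslim : ∀ P : GaloisMonoidPair.{0}, IsMLFGaloisMonoidPair .TM P → H P → IsSlimGroup P.Pi) :
    AutPairCenterFree H := by
  refine autPairCenterFree_of_center_eq_bot fun P hP hH => ?_
  have h := (hslim P hP hH).centralizer_eq_bot ⊤ isOpen_univ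
  rw [← h]
  ext z
  simp [Subgroup.mem_center_iff, Subgroup.mem_centralizer_iff, eq_comm]

end Literature.AnabelianGeometry.AbsoluteAnabelian

end
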